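import Mathlib
import HarnessLib
import Summits.HubbardSuperconductivity.HubbardSuperconductivity.Theorems.KLProgrammeKLRegimeEngineIsoTupleV17FDoor
import Summits.HubbardSuperconductivity.HubbardSuperconductivity.Theorems.KLProgrammeKLRegimeEngineV8DefsQ7
import Summits.HubbardSuperconductivity.HubbardSuperconductivity.Theorems.KLProgrammeKLRegimeSplitFrameDegreeGuard

/-!
# K3 ENGINE-FLOW child (gen 8, stmt-HubbardSuperconductivity-20437 `KLRegimeEngineV17F2`), stub (c), (E5-F)ₙ door input (III):
# the ACCUMULATED-ROWS SMALLNESS reduced to ONE U-door line and ONE volume line (cell gate-hubbard-kl, seat hubbard-kl-k3c2-p2 g8)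

Input (III) of the (E5-F)ₙ door (`…EngineIsoTupleV17FDoor`, `hsmall`) is
`initDevBar G U + legDressBarQ2 G P Q U 0 4 + [3CF(Klam U)² + (cloc Klam²(1−4^{−θ})⁻¹ + 2CR Klam³|U|)U² + Σ_{j<n} Q.CL β j/L + (7/3)CF(Klam U)²
 + 20CR((Klam U)² + (Klam|U|)³) + (4/3)CR(Klam U)²] ≤ U/2`.  Every term but the finite-volume one is `(closed coefficient)·U²` (`|U| ≤ 1`), so (III) follows from
TWO door lines: a U-door `U·D(G,P,Q) ≤ 1/4` with the explicit coefficient sum `D` (§1, `rowsSmallness_of_doors`), and a volume line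
`Σ_{j<n} Q.CL β j / L ≤ U/4` — which at the package `klEngQ7 P R` (`CL β j = 2^60·Psq²·Rsq²·(β²+1)·4^j`) holds for `L ≥ 2^61·Psq²·Rsq²·β³/U` along the
extended ladder `n ≤ n_β + 1` (§2, `sum_CL_klEngQ7_div_le`; `4^{n_β} ≤ β/(32π)`, `four_pow_nScales_le`).  The registered volume witness
`klEngL₃ β U = ⌈β⌉₊² + 2` does NOT give the volume line (FINDING «(c)-E5-L», KL STATUS 2026-08-27 15:04Z: v2 token `klEngL₃ ↦ klEngL₄ P R`); §3
`rowsSmallness_klEng7Q7_of_doors` is (III) at `(klEngGeo7, klEngQ7 P R)` from the two lines.  Arithmetic only; nothing about the model is asserted;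
nothing asserts superconductivity.
-/

noncomputable section

namespace Summit.HubbardSuperconductivity.HubbardSuperconductivity.Theorems.KLRegimeSplit

set_option linter.dupNamespace false -- summit = problem name (single-conjunct summit), D-0017

open Real Finset Literature.MathematicalPhysics.QuantumLattice Literature.Probability.LatticeModels
open Summit.HubbardSuperconductivity.HubbardSuperconductivity.Theorems.KLProgrammeLegKernels
open Summit.HubbardSuperconductivity.HubbardSuperconductivity.Theorems.EngineV8

/-! ## §1 (III) from a U-door and a volume line, any `G P Q` -/

/-- **The accumulated-rows smallness from two door lines.**  With
`D := (Σ_χ(abot χ + atop χ) + 1) + 24·CR·(Klam² + Klam³) + (16/3)·CF·Klam² + cloc·Klam²·(1−4^{−θ})⁻¹ + 2·CR·Klam³ + (4/3)·CR·Klam²`,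
`0 < U ≤ 1`, `U·D ≤ 1/4` and `Σ_{j<n} CL β j / L ≤ U/4` give input (III) of the (E5-F)ₙ door. -/
theorem rowsSmallness_of_doors {G : GeoConsts} {P : SplitConsts} {Q : EngConsts} (hG : G.WF) (hP : P.WF) (hQ : Q.WF) {U : ℝ} (hU : 0 < U)
    (hU1 : U ≤ 1) {β : ℝ} {L n : ℕ}
    (hD : U * ((∑ χ, (G.abot χ + G.atop χ) + 1) + 24 * Q.CR * (P.Klam ^ 2 + P.Klam ^ 3) + 16 / 3 * G.CF * P.Klam ^ 2 +
        G.cloc * P.Klam ^ 2 * (1 - (4 : ℝ) ^ (-G.θ))⁻¹ + 2 * Q.CR * P.Klam ^ 3 + 4 / 3 * Q.CR * P.Klam ^ 2) ≤ 1 / 4)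
    (hCL : ∑ j ∈ range n, Q.CL β j / L ≤ U / 4) :
    initDevBar G U + legDressBarQ2 G P Q U 0 4 +
        (3 * G.CF * (P.Klam * U) ^ 2 +
          ((G.cloc * P.Klam ^ 2 * (1 - (4 : ℝ) ^ (-G.θ))⁻¹ + 2 * Q.CR * P.Klam ^ 3 * |U|) * U ^ 2 + ∑ j ∈ range n, Q.CL β j / L) +
            7 / 3 * (G.CF * (P.Klam * U) ^ 2) + 20 * (Q.CR * ((P.Klam * U) ^ 2 + (P.Klam * |U|) ^ 3)) +
              4 / 3 * (Q.CR * (P.Klam * U) ^ 2)) ≤ U / 2 := by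
  obtain ⟨hatop, habot, -, -, hcloc, hθ, -, -, -, -, -, -, -, hCF, -⟩ := hG
  have hK : 1 ≤ P.Klam := hP.1
  have hK0 : 0 ≤ P.Klam := zero_le_one.trans hK
  have hCR : 0 ≤ Q.CR := hQ.2.1
  have hUabs : |U| = U := abs_of_pos hU
  have hU2 : 0 ≤ U ^ 2 := sq_nonneg U
  have hU3 : U ^ 3 ≤ U ^ 2 := by nlinarith
  -- the geometric factor is nonnegative
  have hr1 : (4 : ℝ) ^ (-G.θ) < 1 := Real.rpow_lt_one_of_one_lt_of_neg (by norm_num) (by linarith)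
  have hgeo : 0 ≤ (1 - (4 : ℝ) ^ (-G.θ))⁻¹ := inv_nonneg.2 (by linarith)
  -- name the coefficients
  set D₀ : ℝ := ∑ χ, (G.abot χ + G.atop χ) + 1 with hD₀
  have hD₀0 : 0 ≤ D₀ := by
    rw [hD₀]; exact add_nonneg (sum_nonneg fun χ _ => add_nonneg (habot χ) (hatop χ)) zero_le_one
  set c₁ : ℝ := G.cloc * P.Klam ^ 2 * (1 - (4 : ℝ) ^ (-G.θ))⁻¹ with hc₁
  have hc₁0 : 0 ≤ c₁ := by rw [hc₁]; positivity
  -- termwise bounds by `coef · U²`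
  have h1 : initDevBar G U = D₀ * U ^ 2 := by rw [initDevBar, hD₀]
  have h2 : legDressBarQ2 G P Q U 0 4 ≤ 4 * Q.CR * (P.Klam ^ 2 + P.Klam ^ 3) * U ^ 2 := by
    rw [legDressBarQ2_eq, hUabs]
    have : Q.CR * ((P.Klam * U) ^ 2 + (P.Klam * U) ^ 3) * ((4 : ℕ) : ℝ) = 4 * Q.CR * (P.Klam ^ 2 * U ^ 2 + P.Klam ^ 3 * U ^ 3) := by
      push_cast; ring
    rw [this]
    have h3' : P.Klam ^ 3 * U ^ 3 ≤ P.Klam ^ 3 * U ^ 2 := mul_le_mul_of_nonneg_left hU3 (pow_nonneg hK0 3)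
    nlinarith [mul_nonneg hCR (pow_nonneg hK0 2)]
  have h3 : 20 * (Q.CR * ((P.Klam * U) ^ 2 + (P.Klam * |U|) ^ 3)) ≤ 20 * Q.CR * (P.Klam ^ 2 + P.Klam ^ 3) * U ^ 2 := by
    rw [hUabs]
    have h3' : P.Klam ^ 3 * U ^ 3 ≤ P.Klam ^ 3 * U ^ 2 := mul_le_mul_of_nonneg_left hU3 (pow_nonneg hK0 3)
    nlinarith [mul_nonneg hCR (pow_nonneg hK0 2)]
  have h4 : (c₁ + 2 * Q.CR * P.Klam ^ 3 * |U|) * U ^ 2 ≤ (c₁ + 2 * Q.CR * P.Klam ^ 3) * U ^ 2 := by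
    rw [hUabs]
    refine mul_le_mul_of_nonneg_right ?_ hU2
    have : 2 * Q.CR * P.Klam ^ 3 * U ≤ 2 * Q.CR * P.Klam ^ 3 * 1 := mul_le_mul_of_nonneg_left hU1 (by positivity)
    linarith
  -- assemble: everything but the CL sum is `≤ D · U² = U·(U·D) ≤ U/4`
  have hsum : D₀ * U ^ 2 + 4 * Q.CR * (P.Klam ^ 2 + P.Klam ^ 3) * U ^ 2 +
      (3 * G.CF * (P.Klam * U) ^ 2 + (c₁ + 2 * Q.CR * P.Klam ^ 3) * U ^ 2) + 7 / 3 * (G.CF * (P.Klam * U) ^ 2) +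
        20 * Q.CR * (P.Klam ^ 2 + P.Klam ^ 3) * U ^ 2 + 4 / 3 * (Q.CR * (P.Klam * U) ^ 2) =
      U * (U * (D₀ + 24 * Q.CR * (P.Klam ^ 2 + P.Klam ^ 3) + 16 / 3 * G.CF * P.Klam ^ 2 + c₁ + 2 * Q.CR * P.Klam ^ 3 +
        4 / 3 * Q.CR * P.Klam ^ 2)) := by ring
  have hD' : U * (U * (D₀ + 24 * Q.CR * (P.Klam ^ 2 + P.Klam ^ 3) + 16 / 3 * G.CF * P.Klam ^ 2 + c₁ + 2 * Q.CR * P.Klam ^ 3 +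
        4 / 3 * Q.CR * P.Klam ^ 2)) ≤ U * (1 / 4) := mul_le_mul_of_nonneg_left hD hU.le
  rw [h1]
  linarith

/-! ## §2 The volume line at the package `klEngQ7 P R` -/

/-- `(klEngQ7 P R).CL β n = 2^60·klEngPsq P²·klEngRsq R²·(β²+1)·4ⁿ` (through the `rfl` rows Q7 → Q6 → Q5 → Q3). -/
theorem klEngQ7_CL_apply (P : SplitConsts) (R : RenConsts) (β : ℝ) (n : ℕ) :
    (klEngQ7 P R).CL β n = 2 ^ 60 * klEngPsq P ^ 2 * klEngRsq R ^ 2 * (β ^ 2 + 1) * (4 : ℝ) ^ n := rfl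

/-- **The volume line at `klEngQ7`**: for `klBetaMin ≤ β`, `n ≤ n_β + 1`, `0 < U` and `2^61·Psq²·Rsq²·β³/U ≤ L`,
`Σ_{j<n} (klEngQ7 P R).CL β j / L ≤ U/4`. -/
theorem sum_CL_klEngQ7_div_le (P : SplitConsts) (R : RenConsts) {β U : ℝ} (hβ : klBetaMin ≤ β) (hU : 0 < U) {n L : ℕ}
    (hn : n ≤ nScales β + 1) (hL : 2 ^ 61 * klEngPsq P ^ 2 * klEngRsq R ^ 2 * β ^ 3 / U ≤ (L : ℝ)) :
    ∑ j ∈ range n, (klEngQ7 P R).CL β j / (L : ℝ) ≤ U / 4 := by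
  have hβ0 : 0 < β := pos_of_klBetaMin_le hβ
  have hβ1 : (128 : ℝ) ≤ β := by rw [klBetaMin] at hβ; exact hβ
  have hπ3 := Real.pi_gt_three
  set A : ℝ := 2 ^ 60 * klEngPsq P ^ 2 * klEngRsq R ^ 2 with hA
  have hA0 : 0 < A := by rw [hA]; have := klEngPsq_pos P; have := klEngRsq_pos R; positivity
  have hL0 : (0 : ℝ) < L := by
    refine lt_of_lt_of_le ?_ hL
    have : 0 < 2 ^ 61 * klEngPsq P ^ 2 * klEngRsq R ^ 2 * β ^ 3 / U := by
      have := klEngPsq_pos P; have := klEngRsq_pos R; positivity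
    exact this
  -- the geometric sum of `4^j`
  have hgeom : ∑ j ∈ range n, (4 : ℝ) ^ j ≤ (4 : ℝ) ^ n / 3 := by
    have h := geom_sum_eq (x := (4 : ℝ)) (by norm_num) n
    rw [h]
    have : (0 : ℝ) < (4 : ℝ) ^ n := by positivity
    rw [div_le_div_iff₀ (by norm_num) (by norm_num)]
    nlinarith
  have h4n : (4 : ℝ) ^ n ≤ 4 * (4 : ℝ) ^ nScales β := by
    calc (4 : ℝ) ^ n ≤ (4 : ℝ) ^ (nScales β + 1) := pow_le_pow_right₀ (by norm_num) hn
      _ = 4 * (4 : ℝ) ^ nScales β := by rw [pow_succ]; ring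
  have h4β : (4 : ℝ) ^ n ≤ β / (8 * Real.pi) := by
    refine h4n.trans ?_
    have h := four_pow_nScales_le hβ
    rw [klE0] at h
    -- `4·(β/32)/π = β/(8π)`
    have : 4 * (1 / 32 * β / Real.pi) = β / (8 * Real.pi) := by
      field_simp
      ring
    rw [← this]
    linarith
  -- `Σ 4^j ≤ β/(24π)`
  have hS : ∑ j ∈ range n, (4 : ℝ) ^ j ≤ β / (24 * Real.pi) := by
    refine hgeom.trans ?_
    have : β / (8 * Real.pi) / 3 = β / (24 * Real.pi) := by
      field_simp
      ring
    rw [← this]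
    exact div_le_div_of_nonneg_right h4β (by norm_num)
  -- `Σ CL/L = A(β²+1)/L · Σ 4^j`
  have hsum : ∑ j ∈ range n, (klEngQ7 P R).CL β j / (L : ℝ) = A * (β ^ 2 + 1) / L * ∑ j ∈ range n, (4 : ℝ) ^ j := by
    rw [Finset.mul_sum]
    refine sum_congr rfl fun j _ => ?_
    rw [klEngQ7_CL_apply, hA]
    ring
  rw [hsum]
  have hc0 : 0 ≤ A * (β ^ 2 + 1) / L :=
    div_nonneg (mul_nonneg hA0.le (add_nonneg (sq_nonneg β) zero_le_one)) (Nat.cast_nonneg L)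
  -- `U·L ≥ 2A·β³`
  have hUL : 2 * A * β ^ 3 ≤ U * L := by
    have h2A : (2 : ℝ) ^ 61 * klEngPsq P ^ 2 * klEngRsq R ^ 2 = 2 * A := by rw [hA]; ring
    have h := hL
    rw [h2A, div_le_iff₀ hU] at h
    linarith
  calc A * (β ^ 2 + 1) / L * ∑ j ∈ range n, (4 : ℝ) ^ j ≤ A * (β ^ 2 + 1) / L * (β / (24 * Real.pi)) :=
        mul_le_mul_of_nonneg_left hS hc0
    _ = A * (β ^ 2 + 1) * β / (L * (24 * Real.pi)) := by rw [div_mul_div_comm]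
    _ ≤ U / 4 := by
        rw [div_le_div_iff₀ (by positivity) (by norm_num)]
        have hb2 : β ^ 2 + 1 ≤ 2 * β ^ 2 := by nlinarith
        have h1 : A * (β ^ 2 + 1) * β * 4 ≤ 8 * A * β ^ 3 := by
          have := mul_le_mul_of_nonneg_left hb2 hA0.le
          nlinarith [mul_nonneg hA0.le (le_of_lt hβ0)]
        have h2 : 8 * A * β ^ 3 ≤ 4 * (U * L) := by linarith
        have h3 : 4 * (U * (L : ℝ)) ≤ U * (L * (24 * Real.pi)) := by nlinarith [mul_pos hU hL0]
        linarith

/-! ## §3 (III) at the registered package -/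

/-- **Input (III) of the (E5-F)ₙ door at `(klEngGeo7, klEngQ7 P R)` from ONE U-door line and ONE volume line.** -/
theorem rowsSmallness_klEng7Q7_of_doors (P : SplitConsts) (R : RenConsts) (hP : P.WF) {β U : ℝ} (hβ : klBetaMin ≤ β) (hU : 0 < U)
    (hU1 : U ≤ 1) {n L : ℕ} (hn : n ≤ nScales β + 1)
    (hD : U * ((∑ χ, (klEngGeo7.abot χ + klEngGeo7.atop χ) + 1) + 24 * (klEngQ7 P R).CR * (P.Klam ^ 2 + P.Klam ^ 3) +
        16 / 3 * klEngGeo7.CF * P.Klam ^ 2 + klEngGeo7.cloc * P.Klam ^ 2 * (1 - (4 : ℝ) ^ (-klEngGeo7.θ))⁻¹ +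
          2 * (klEngQ7 P R).CR * P.Klam ^ 3 + 4 / 3 * (klEngQ7 P R).CR * P.Klam ^ 2) ≤ 1 / 4)
    (hL : 2 ^ 61 * klEngPsq P ^ 2 * klEngRsq R ^ 2 * β ^ 3 / U ≤ (L : ℝ)) :
    initDevBar klEngGeo7 U + legDressBarQ2 klEngGeo7 P (klEngQ7 P R) U 0 4 +
        (3 * klEngGeo7.CF * (P.Klam * U) ^ 2 +
          ((klEngGeo7.cloc * P.Klam ^ 2 * (1 - (4 : ℝ) ^ (-klEngGeo7.θ))⁻¹ + 2 * (klEngQ7 P R).CR * P.Klam ^ 3 * |U|) * U ^ 2 +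
              ∑ j ∈ range n, (klEngQ7 P R).CL β j / L) +
            7 / 3 * (klEngGeo7.CF * (P.Klam * U) ^ 2) + 20 * ((klEngQ7 P R).CR * ((P.Klam * U) ^ 2 + (P.Klam * |U|) ^ 3)) +
              4 / 3 * ((klEngQ7 P R).CR * (P.Klam * U) ^ 2)) ≤ U / 2 :=
  rowsSmallness_of_doors klEngGeo7_wf hP (klEngQ7_wf P R) hU hU1 hD (sum_CL_klEngQ7_div_le P R hβ hU hn hL)

end Summit.HubbardSuperconductivity.HubbardSuperconductivity.Theorems.KLRegimeSplit

end
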